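import Literature.Geometry.Lorentzian.CommutingFlowLocal
import Literature.Geometry.Lorentzian.StationaryOrbitHorizontalFlow
import Literature.Geometry.Lorentzian.KillingFieldOnNaturality
import HarnessLib

/-!
# The field transported by a flow: `(θₜ)_* W = (θ₋ₜ)^* W`

Companion of `CommutingFlowLocal.lean` (local form of Lee 2012, Thm. 9.42).  For a flow
`θ : ℝ × M → M` with the group law on a manifold modelled on `𝓘(ℝ, E)`, Mathlib's pullback
`VectorField.mpullback` along the flow map `θ₋ₜ` is the push-forward `(θₜ)_* W` of a vector field
`W` (Lee 2012, (9.20); the operation `Y ↦ φₜ[X]_* Y` by which Chruściel–Costa 2008, §2.2 and §4.1,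
move Killing fields defined near the horizon with the stationary isometries).  We record:

* `inverse_mfderiv_flow_neg`, `mpullback_flow_neg_apply` — `(dθ₋ₜ|_y)⁻¹ = dθₜ|_{θ₋ₜ y}`, so
  `((θ₋ₜ)^* W)(y) = dθₜ (W (θ₋ₜ y))`;
* `mpullback_flow_neg_self` — `(θ₋ₜ)^* V = V` for the generating field `V`
  (`mfderiv_flow_apply_self`, `StationaryOrbitHorizontalFlow.lean`);
* `contMDiffOn_mpullback_flow_neg` — `(θ₋ₜ)^* W` is `C^∞` on `θₜ(𝒪) = θ₋ₜ⁻¹(𝒪)` when `W` is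
  `C^∞` on `𝒪`;
* `mlieBracket_mpullback_flow_neg`, `mlieBracket_mpullback_flow_neg_eq_zero` — naturality of the
  bracket: `[V, (θ₋ₜ)^* W] = (θ₋ₜ)^* [V, W]`, so fields commuting with `V` are transported to fields
  commuting with `V`;
* `mpullback_flow_neg_apply_eq_self_of_forall_uIcc_mem` — along orbit pieces inside the open set
  where `W` is `C^∞` and `[V, W] = 0`, the transported field IS `W`
  (`mfderiv_flow_apply_eq_of_forall_uIcc_mem`).

* `PseudoRiemannianMetric.IsKillingFieldOn.mpullback_flow_neg` — when the `θₛ` are isometries of a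
  smooth metric `g` (`KillingFieldOnNaturality.lean`), `(θ₋ₜ)^* X` is a Killing field of `g` on
  `θₜ(𝒪)` if `X` is one on `𝒪`.

This is the tool-kit for extending a local Killing field commuting with a complete Killing field
`V` along the flow of `V` (by isometries).  Everything is proved; no definitions, no named facts.

## References

* J. M. Lee, *Introduction to Smooth Manifolds*, 2nd ed., GTM 218, Springer 2012, Thm. 9.12,
  Prop. 9.13, (9.20), Cor. 9.39, Thm. 9.42. (key `LeeSmoothManifolds2013`)
* P. T. Chruściel, J. L. Costa, Astérisque 321 (2008) 195–265 = arXiv:0806.0016, §2.2, §4.1.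
  (key `ChruscielCosta2008`)
-/

noncomputable section

open Bundle Set Function Filter VectorField
open scoped Manifold ContDiff Topology

namespace Literature.Geometry.Lorentzian

variable {E : Type*} [NormedAddCommGroup E] [NormedSpace ℝ E] [CompleteSpace E]
  {M : Type*} [TopologicalSpace M] [ChartedSpace E M] [IsManifold 𝓘(ℝ, E) ∞ M] [T2Space M]
  {V W : Π x : M, TangentSpace 𝓘(ℝ, E) x} {θ : ℝ × M → M}

/-! ### The transported field `(θₜ)_* W = (θ₋ₜ)^* W` -/

omit [CompleteSpace E] [IsManifold 𝓘(ℝ, E) ∞ M] [T2Space M] in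
/-- **`(dθ₋ₜ|_y)⁻¹ = dθₜ|_{θ₋ₜ y}`** for a `C²` flow with the group law (`dθ₋ₜ ∘ dθₜ = id` and
`dθₜ ∘ dθ₋ₜ = id`, `mfderiv_flow_neg_apply_mfderiv_flow`). Lee 2012, Thm. 9.12 (b).
[cite: LeeSmoothManifolds2013, Thm. 9.12] -/
theorem inverse_mfderiv_flow_neg (hθ : ContMDiff (𝓘(ℝ, ℝ).prod 𝓘(ℝ, E)) 𝓘(ℝ, E) 2 θ)
    (hθ0 : ∀ p, θ (0, p) = p) (hθadd : ∀ t s p, θ (t, θ (s, p)) = θ (t + s, p)) (t : ℝ) (y : M) :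
    (mfderiv 𝓘(ℝ, E) 𝓘(ℝ, E) (fun q ↦ θ (-t, q)) y).inverse =
      mfderiv 𝓘(ℝ, E) 𝓘(ℝ, E) (fun q ↦ θ (t, q)) (θ (-t, y)) := by
  have hy : θ (t, θ (-t, y)) = y := flow_apply_flow_neg hθ0 hθadd t y
  refine ContinuousLinearMap.inverse_eq ?_ ?_
  · -- `dθ₋ₜ|_y ∘ dθₜ|_{θ₋ₜ y} = id`: the case `-t`, base point `θ₋ₜ y`
    ext v
    have h := PseudoRiemannianMetric.mfderiv_flow_neg_apply_mfderiv_flow hθ hθ0 hθadd t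
      (θ (-t, y)) v
    rw [hy] at h
    exact h
  · -- `dθₜ|_{θ₋ₜ y} ∘ dθ₋ₜ|_y = id`: the case `t ↦ -t`, base point `y`
    ext v
    have h := PseudoRiemannianMetric.mfderiv_flow_neg_apply_mfderiv_flow hθ hθ0 hθadd (-t) y v
    rw [neg_neg] at h
    exact h

omit [CompleteSpace E] [IsManifold 𝓘(ℝ, E) ∞ M] [T2Space M] in
/-- **The transported field.** For a `C²` flow with the group law,
`((θ₋ₜ)^* W)(y) = dθₜ|_{θ₋ₜ y} (W (θ₋ₜ y))`: Mathlib's pullback `mpullback` along `θ₋ₜ` is the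
push-forward `(θₜ)_* W` of Lee 2012, (9.20) / Chruściel–Costa 2008, §2.2 (`φₜ[X]_*`).
[cite: LeeSmoothManifolds2013, Thm. 9.42] -/
theorem mpullback_flow_neg_apply (hθ : ContMDiff (𝓘(ℝ, ℝ).prod 𝓘(ℝ, E)) 𝓘(ℝ, E) 2 θ)
    (hθ0 : ∀ p, θ (0, p) = p) (hθadd : ∀ t s p, θ (t, θ (s, p)) = θ (t + s, p)) (t : ℝ)
    (W : Π x : M, TangentSpace 𝓘(ℝ, E) x) (y : M) :
    mpullback 𝓘(ℝ, E) 𝓘(ℝ, E) (fun q ↦ θ (-t, q)) W y =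
      mfderiv 𝓘(ℝ, E) 𝓘(ℝ, E) (fun q ↦ θ (t, q)) (θ (-t, y)) (W (θ (-t, y))) := by
  rw [mpullback_apply, inverse_mfderiv_flow_neg hθ hθ0 hθadd t y]
  rfl

omit [CompleteSpace E] [IsManifold 𝓘(ℝ, E) ∞ M] [T2Space M] in
/-- **`V` is transported to itself**: `(θ₋ₜ)^* V = V` (`mfderiv_flow_apply_self` of
`StationaryOrbitHorizontalFlow.lean` at `θ₋ₜ y`, and the group law). Lee 2012, Prop. 9.13.
[cite: LeeSmoothManifolds2013, Thm. 9.42] -/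
theorem mpullback_flow_neg_self (hθ : ContMDiff (𝓘(ℝ, ℝ).prod 𝓘(ℝ, E)) 𝓘(ℝ, E) 2 θ)
    (hθV : ∀ p, IsMIntegralCurve (fun t ↦ θ (t, p)) V) (hθ0 : ∀ p, θ (0, p) = p)
    (hθadd : ∀ t s p, θ (t, θ (s, p)) = θ (t + s, p)) (t : ℝ) :
    mpullback 𝓘(ℝ, E) 𝓘(ℝ, E) (fun q ↦ θ (-t, q)) V = V := by
  funext y
  rw [mpullback_flow_neg_apply hθ hθ0 hθadd t V y,
    mfderiv_flow_apply_self hθ hθ0 hθadd hθV t (θ (-t, y)),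
    flow_apply_flow_neg hθ0 hθadd]

omit [T2Space M] in
/-- **The transported field is smooth on the transported set**: if `W` is `C^∞` on `𝒪` then
`(θ₋ₜ)^* W` is `C^∞` on `θ₋ₜ ⁻¹' 𝒪 = θₜ(𝒪)` for a `C^∞` flow with the group law (Mathlib's
`ContMDiffOn.mpullback_vectorField_preimage`, the differentials of `θ₋ₜ` being invertible).
[cite: LeeSmoothManifolds2013, Thm. 9.42] -/
theorem contMDiffOn_mpullback_flow_neg (hθ : ContMDiff (𝓘(ℝ, ℝ).prod 𝓘(ℝ, E)) 𝓘(ℝ, E) ∞ θ)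
    (hθ0 : ∀ p, θ (0, p) = p) (hθadd : ∀ t s p, θ (t, θ (s, p)) = θ (t + s, p)) (t : ℝ)
    {𝒪 : Set M}
    (hW : ContMDiffOn 𝓘(ℝ, E) 𝓘(ℝ, E).tangent ∞
      (fun x ↦ (⟨x, W x⟩ : TangentBundle 𝓘(ℝ, E) M)) 𝒪) :
    ContMDiffOn 𝓘(ℝ, E) 𝓘(ℝ, E).tangent ∞
      (fun x ↦ (⟨x, mpullback 𝓘(ℝ, E) 𝓘(ℝ, E) (fun q ↦ θ (-t, q)) W x⟩ :
        TangentBundle 𝓘(ℝ, E) M)) ((fun q ↦ θ (-t, q)) ⁻¹' 𝒪) := by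
  have hθ2 : ContMDiff (𝓘(ℝ, ℝ).prod 𝓘(ℝ, E)) 𝓘(ℝ, E) 2 θ :=
    hθ.of_le (WithTop.coe_le_coe.mpr le_top)
  have hθt : ContMDiff 𝓘(ℝ, E) 𝓘(ℝ, E) ∞ (fun q ↦ θ (-t, q)) :=
    hθ.comp (contMDiff_const.prodMk contMDiff_id)
  have hinv : ∀ y, (mfderiv 𝓘(ℝ, E) 𝓘(ℝ, E) (fun q ↦ θ (-t, q)) y).IsInvertible := by
    intro y
    have hy : θ (t, θ (-t, y)) = y := flow_apply_flow_neg hθ0 hθadd t y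
    refine ContinuousLinearMap.IsInvertible.of_inverse
      (g := mfderiv 𝓘(ℝ, E) 𝓘(ℝ, E) (fun q ↦ θ (t, q)) (θ (-t, y))) ?_ ?_
    · ext v
      have h := PseudoRiemannianMetric.mfderiv_flow_neg_apply_mfderiv_flow hθ2 hθ0 hθadd t
        (θ (-t, y)) v
      rw [hy] at h
      exact h
    · ext v
      have h := PseudoRiemannianMetric.mfderiv_flow_neg_apply_mfderiv_flow hθ2 hθ0 hθadd (-t)
        y v
      rw [neg_neg] at h
      exact h
  exact hW.mpullback_vectorField_preimage hθt (fun y _ ↦ hinv y) (by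
    exact_mod_cast le_top)

omit [T2Space M] in
/-- **Transport preserves commutation with `V`**: `[V, (θ₋ₜ)^* W](y) = ((θ₋ₜ)^* [V, W])(y)` for
`V` `C^∞` with a `C^∞` flow (group law) and `W` differentiable at `θ₋ₜ y` — naturality of the Lie
bracket (Mathlib's `VectorField.mpullback_mlieBracket`) and `(θ₋ₜ)^* V = V`
(`mpullback_flow_neg_self`). In particular `[V, W](θ₋ₜ y) = 0` gives `[V, (θ₋ₜ)^* W](y) = 0`
(`mlieBracket_mpullback_flow_neg_eq_zero`). Lee 2012, Cor. 9.39 / Thm. 9.42.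
[cite: LeeSmoothManifolds2013, Thm. 9.42] -/
theorem mlieBracket_mpullback_flow_neg
    (hV : ContMDiff 𝓘(ℝ, E) 𝓘(ℝ, E).tangent ∞ (fun x ↦ (⟨x, V x⟩ : TangentBundle 𝓘(ℝ, E) M)))
    (hθ : ContMDiff (𝓘(ℝ, ℝ).prod 𝓘(ℝ, E)) 𝓘(ℝ, E) ∞ θ)
    (hθV : ∀ p, IsMIntegralCurve (fun t ↦ θ (t, p)) V) (hθ0 : ∀ p, θ (0, p) = p)
    (hθadd : ∀ t s p, θ (t, θ (s, p)) = θ (t + s, p)) (t : ℝ) {y : M}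
    (hW : MDiffAt (T% W) (θ (-t, y))) :
    mlieBracket 𝓘(ℝ, E) V (mpullback 𝓘(ℝ, E) 𝓘(ℝ, E) (fun q ↦ θ (-t, q)) W) y =
      mpullback 𝓘(ℝ, E) 𝓘(ℝ, E) (fun q ↦ θ (-t, q)) (mlieBracket 𝓘(ℝ, E) V W) y := by
  haveI : IsManifold 𝓘(ℝ, E) (minSmoothness ℝ 2) M := by
    rw [minSmoothness_of_isRCLikeNormedField]
    infer_instance
  have hθ2 : ContMDiff (𝓘(ℝ, ℝ).prod 𝓘(ℝ, E)) 𝓘(ℝ, E) 2 θ :=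
    hθ.of_le (WithTop.coe_le_coe.mpr le_top)
  have hθt : ContMDiffAt 𝓘(ℝ, E) 𝓘(ℝ, E) ∞ (fun q ↦ θ (-t, q)) y :=
    (hθ.comp (contMDiff_const.prodMk contMDiff_id)).contMDiffAt
  have key := mpullback_mlieBracket (I := 𝓘(ℝ, E)) (I' := 𝓘(ℝ, E)) (f := fun q ↦ θ (-t, q))
    (V := V) (W := W) (x₀ := y) ((hV _).mdifferentiableAt (by simp)) hW hθt (by
      rw [minSmoothness_of_isRCLikeNormedField]
      exact (ENat.LEInfty.out : (2 : ℕ∞ω) ≤ ∞))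
  rw [mpullback_flow_neg_self hθ2 hθV hθ0 hθadd t] at key
  exact key.symm

omit [T2Space M] in
/-- **A field commuting with `V` is transported to a field commuting with `V`**: if
`[V, W](θ₋ₜ y) = 0` (and `W` is differentiable there) then `[V, (θ₋ₜ)^* W](y) = 0`. Lee 2012,
Thm. 9.42; this is why the Killing field `φₜ[X]_* Y` of Chruściel–Costa 2008, §4.1 still commutes
with the stationary Killing field `X`. [cite: LeeSmoothManifolds2013, Thm. 9.42] -/
theorem mlieBracket_mpullback_flow_neg_eq_zero
    (hV : ContMDiff 𝓘(ℝ, E) 𝓘(ℝ, E).tangent ∞ (fun x ↦ (⟨x, V x⟩ : TangentBundle 𝓘(ℝ, E) M)))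
    (hθ : ContMDiff (𝓘(ℝ, ℝ).prod 𝓘(ℝ, E)) 𝓘(ℝ, E) ∞ θ)
    (hθV : ∀ p, IsMIntegralCurve (fun t ↦ θ (t, p)) V) (hθ0 : ∀ p, θ (0, p) = p)
    (hθadd : ∀ t s p, θ (t, θ (s, p)) = θ (t + s, p)) (t : ℝ) {y : M}
    (hW : MDiffAt (T% W) (θ (-t, y))) (hVW : mlieBracket 𝓘(ℝ, E) V W (θ (-t, y)) = 0) :
    mlieBracket 𝓘(ℝ, E) V (mpullback 𝓘(ℝ, E) 𝓘(ℝ, E) (fun q ↦ θ (-t, q)) W) y = 0 := by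
  rw [mlieBracket_mpullback_flow_neg hV hθ hθV hθ0 hθadd t hW, mpullback_apply, hVW, map_zero]

/-- **The transported field agrees with `W` along orbit pieces inside the good set**: if `W` is
`C^∞` with `[V, W] = 0` on the open set `𝒪`, `V ≠ 0` at `θ₋ₜ y`, and the orbit segment from
`θ₋ₜ y` to `y` (`θ(s, θ₋ₜ y)`, `s` between `0` and `t`) lies in `𝒪`, then `((θ₋ₜ)^* W)(y) = W y`
(`mfderiv_flow_apply_eq_of_forall_uIcc_mem` at `θ₋ₜ y`). Lee 2012, Thm. 9.42; Chruściel–Costa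
2008, §4.1 (`φₜ[X]_* Y = Y` near the horizon). [cite: LeeSmoothManifolds2013, Thm. 9.42] -/
theorem mpullback_flow_neg_apply_eq_self_of_forall_uIcc_mem
    (hV : ContMDiff 𝓘(ℝ, E) 𝓘(ℝ, E).tangent ∞ (fun x ↦ (⟨x, V x⟩ : TangentBundle 𝓘(ℝ, E) M)))
    {𝒪 : Set M} (h𝒪 : IsOpen 𝒪)
    (hW : ∀ x ∈ 𝒪,
      ContMDiffAt 𝓘(ℝ, E) 𝓘(ℝ, E).tangent ∞ (fun x ↦ (⟨x, W x⟩ : TangentBundle 𝓘(ℝ, E) M)) x)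
    (hVW : ∀ x ∈ 𝒪, mlieBracket 𝓘(ℝ, E) V W x = 0)
    (hθ : ContMDiff (𝓘(ℝ, ℝ).prod 𝓘(ℝ, E)) 𝓘(ℝ, E) 2 θ)
    (hθV : ∀ p, IsMIntegralCurve (fun t ↦ θ (t, p)) V) (hθ0 : ∀ p, θ (0, p) = p)
    (hθadd : ∀ t s p, θ (t, θ (s, p)) = θ (t + s, p)) (t : ℝ) {y : M}
    (hy : V (θ (-t, y)) ≠ 0) (hseg : ∀ s ∈ uIcc 0 t, θ (s, θ (-t, y)) ∈ 𝒪) :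
    mpullback 𝓘(ℝ, E) 𝓘(ℝ, E) (fun q ↦ θ (-t, q)) W y = W y := by
  rw [mpullback_flow_neg_apply hθ hθ0 hθadd t W y,
    mfderiv_flow_apply_eq_of_forall_uIcc_mem hV h𝒪 hW hVW hθ hθV hθ0 hθadd hy hseg,
    flow_apply_flow_neg hθ0 hθadd]

/-! ### When the flow maps are isometries: the transported Killing field -/

omit [T2Space M] in
/-- **The stationary isometries transport local Killing fields**: if every flow map `θₛ` is an
infinitesimal isometry of the smooth metric `g` (`g(dθₛ v, dθₛ w) = g(v, w)`, the clause delivered by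
`StationaryAFBlackHole.exists_stationary_flow`) and `X` is a Killing field of `g` on the open set `𝒪`,
then `(θ₋ₜ)^* X = (θₜ)_* X` is a Killing field of `g` on `θ₋ₜ ⁻¹' 𝒪 = θₜ(𝒪)`
(`IsKillingFieldOn.mpullback_of_val_mfderiv_eq` with `Φ = θ₋ₜ`; smoothness of pull-backs of metrics
is `contMDiff_pullbackBilin_holds`). This is the Killing field `φₜ[X]_* Y` of Chruściel–Costa 2008,
§2.2 and §4.1; O'Neill 1983, Ch. 9, p. 250. [cite: ONeill1983, Ch. 9, Prop. 9.25] -/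
theorem PseudoRiemannianMetric.IsKillingFieldOn.mpullback_flow_neg [FiniteDimensional ℝ E]
    {g : PseudoRiemannianMetric 𝓘(ℝ, E) ∞ E (TangentSpace 𝓘(ℝ, E) : M → Type _)} [g.HasLeviCivita]
    (hθ : ContMDiff (𝓘(ℝ, ℝ).prod 𝓘(ℝ, E)) 𝓘(ℝ, E) ∞ θ)
    (hiso : ∀ (s : ℝ) (x : M) (v w : TangentSpace 𝓘(ℝ, E) x),
      g.val (θ (s, x)) (mfderiv 𝓘(ℝ, E) 𝓘(ℝ, E) (fun q ↦ θ (s, q)) x v)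
        (mfderiv 𝓘(ℝ, E) 𝓘(ℝ, E) (fun q ↦ θ (s, q)) x w) = g.val x v w)
    (t : ℝ) {X : Π x : M, TangentSpace 𝓘(ℝ, E) x} {𝒪 : Set M} (h𝒪 : IsOpen 𝒪)
    (hX : g.IsKillingFieldOn X 𝒪) :
    g.IsKillingFieldOn (mpullback 𝓘(ℝ, E) 𝓘(ℝ, E) (fun q ↦ θ (-t, q)) X)
      ((fun q ↦ θ (-t, q)) ⁻¹' 𝒪) := by
  have h1 : ((∞ : ℕ∞ω) + 1) = ∞ := rfl
  have hθt : ContMDiff 𝓘(ℝ, E) 𝓘(ℝ, E) (∞ + 1) (fun q ↦ θ (-t, q)) := by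
    rw [h1]
    exact hθ.comp (contMDiff_const.prodMk contMDiff_id)
  exact PseudoRiemannianMetric.IsKillingFieldOn.mpullback_of_val_mfderiv_eq g
    PseudoRiemannianMetric.contMDiff_pullbackBilin_holds hθt (hiso (-t)) h𝒪 hX

end Literature.Geometry.Lorentzian

end
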